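import Summits.ABC.IUTFork.Repair.ModelColumnVarying2
import Summits.ABC.IUTFork.Repair.CandInternal9
import Summits.ABC.IUTFork.Repair.CandInternal12
import Summits.ABC.IUTFork.Repair.CandInternal15
import HarnessLib

/-!
# REPAIR branch — E1, part III: the COLUMN axis of the T-b PROFILE (REPAIR-SPEC v0.4 §3, «Column axis: E1») — cells of the
# column-READING transport rows RP-I08a/b/c, RP-I12, RP-I15 on the column-varying bed CV (`cvSetting`, `cvSettingId`), and a SAT♮ engine

Proof-only file (no definition, no candidate, no `Prop` fact) of the abc-iut cell's IUT REPAIR branch (rung LADDER-ABC:A2.RP ⊆ A2.B), seat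
abc-iut-w5-d049; sequel of `Repair/ModelColumnVarying` (p431817) / `ModelColumnVarying2` (p432127). TAKES NO SIDE between Mochizuki,
Scholze–Stix or anyone; nothing here asserts abc or [IUTchIII] Cor. 3.12 proved or refuted; models are TEST OBJECTS; typed ≠ proved;
instantiated ≠ endorsed. Candidates consumed BY NAME, zero edits: abc-iut-rp-d3's `CandInternal9` (RP-I08a `H` = (T1) transport along a
ρ-INVISIBLE family ∧ (T2); RP-I08b `HΘ` = Θ-side ρ-invisible compatibility of the columns `n−1`, `n`; RP-I08c `HStab`; p428071),
`CandInternal12` (RP-I12 `H qK 𝒞` = transport along a member of the class `𝒞`, p428535), abc-iut-rp-d2's `CandInternal15` (RP-I15 `H` =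
transport along a UNITS-TYPE family, p428974). [claim: Mochizuki2012, status: disputed]

WHY THESE ROWS. They are exactly the landed candidates that READ THE PREVIOUS COLUMN `S.col (P.n − 1)` (with RP-I01, part I); on every
bed of record before CV the columns are constant, so there «previous column» = «own column» and the cells of these rows could not see the
link's change of column. On CV the previous column reads the flipped line: `(cvFull.col (n−1)).frobΨ m = qDatumNat = flipFamily · PsiNat`
while `(cvFull.col n).frobΨ m = PsiNat` (`cv_col_frobΨ`).

CELLS (kernel; `cvSetting` = honest q-glue `halfNeg`, datum `qDatumNat`; `cvSettingId` = q-glue ON the Θ-region, datum `PsiNat`):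
* RP-I08a `H`: **HOLDS at `cvSetting` with the TRIVIAL transporter `Φ₀ = 1`** (ρ-invisible) — at P♮ it FAILS (`CandInternal9.H_fails_at_natSetting`:
  there the only transporter is `flipFamily`, ρ-visible); FAILS at `cvSettingId`. So RP-I08a's «STRICTLY STRONGER than S / T-c SAT0» reading
  at P♮ is BED-DEPENDENT exactly as RP-I01's: on CV it is SAT♮ (`I08a_satCV`).
* RP-I08b `HΘ` (Θ-side only): **FAILS on CV** (both settings; it reads no q-datum) — it HELD on every earlier bed (`HΘ_at_pinned_countermodel`,
  `HΘ_holds_on_oneRho`, `HΘ_at_linkId`, `HΘ_at_natSetting`: constant columns, `Φ₀ = 1`). First model of the typed Thm. 3.11 (i)(ii)(iii) with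
  pins, bridge hypotheses, `S` and the Statement on which `HΘ` is FALSE: the typed interface does NOT imply it (`not_interface_imp_I08b`) —
  `HΘ` EXCLUDES a genuine (region-moving) change of Kummer image between adjacent columns.
* RP-I08c `HStab`: FAILS on CV (as at P♮; it reads column `n` only).
* RP-I12 `H qK 𝒞`: at `cvSetting` HOLDS for EVERY class `𝒞 ∋ 1` — in particular for RP-I01's trivial class `{1}`, which FAILS at P♮
  (`CandInternal12.H_one_fails_at_natSetting`); at `cvSettingId` HOLDS iff-style for `𝒞 ∋ flipFamily` and FAILS for `{1}`.
* RP-I15 `H`: HOLDS at both CV settings (`Φ₀ = 1`, resp. `Φ₀ = flipFamily`, both units-type) — as at P♮; CV does not move this row.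
ENGINE `satCV_of_holds_at_cvSetting`: any candidate of the protocol's arity TRUE at `cvSetting` is jointly satisfiable with typed Thm. 3.11 ∧
`col (n−1) ≠ col n` ∧ BridgeHyps ∧ `|log(q)| > 0` ∧ PinnedRegions3 ∧ all four levels of record ∧ Statement STRICT ∧ `¬IdentifiedReading`
(grade SAT♮, honesty vector = P♮'s: every interface clause, `hindep`; `hscaled` fails). READING for the table (neutral): the transport rows
split on CV by WHAT CARRIES THE TRANSPORT — rows reading the previous column (I01, I08a, I12 with any `𝒞 ∋ 1`, I15) are satisfied by the
LINK ITSELF at a non-identified model; rows demanding Θ-side agreement of adjacent columns up to ρ-invisible families (I08b) are refuted there.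
-/

noncomputable section

open Set

namespace Summit.ABC.IUTFork.Repair.ModelColumnVarying

open Thm311 Cor312 Cor312.Checks Cor312.IdentifiedNonVacuity Cor312Vol Cor312Vol.NaiveWitness Cor312Vol.PinnedWitness
  Cor312Vol.NaturalWitness Literature.IUT.LogThetaLattice

/-! ## 13. The two columns the rows read, and the `flipFamily` involution -/

/-- On CV the setting's OWN column `n = 0` carries the Kummer image `PsiNat`, the PREVIOUS column `n − 1 = −1` the flipped datum
`qDatumNat` — for both settings `cvSetting`, `cvSettingId` (both sit at column `0`). [folklore] -/
theorem cv_col_frobΨ (m : ℤ) :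
    (cvFull.toLatticeSituation.col cvSetting.n).frobΨ m = (fun v _ => PsiNat v) ∧
      (cvFull.toLatticeSituation.col (cvSetting.n - 1)).frobΨ m = qDatumNat ∧
      (cvFull.toLatticeSituation.col cvSettingId.n).frobΨ m = (fun v _ => PsiNat v) ∧
      (cvFull.toLatticeSituation.col (cvSettingId.n - 1)).frobΨ m = qDatumNat := by
  have h : (cvColumn (0 - 1)).frobΨ m = qDatumNat := by rw [cvColumn_of_ne_zero (by decide)]; rfl
  exact ⟨rfl, h, rfl, h⟩

/-- `flipFamily` is an involution on the product packets (`−(−x) = x`). [folklore] -/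
theorem starAut_flipFamily_starAut_flipFamily (v : toyIndex.V) (x : signShells.StarPacket v) :
    signShells.starAut flipFamily v (signShells.starAut flipFamily v x) = x := by
  funext j
  simp only [LogShells.starAut, LinearEquiv.piCongrRight_apply, flipFamily_apply, neg_neg]

/-- … hence transporting twice by `flipFamily` returns every bad-place datum; in particular `flipFamily · qDatumNat = PsiNat`. [folklore] -/
theorem starAut_flipFamily_image_qDatumNat (v : toyIndex.V) (hv : v ∈ toyIndex.Vbad) :
    signShells.starAut flipFamily v '' qDatumNat v hv = PsiNat v := by
  ext x
  constructor
  · rintro ⟨_, ⟨y, hy, rfl⟩, rfl⟩; rw [starAut_flipFamily_starAut_flipFamily]; exact hy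
  · intro hx; exact ⟨_, ⟨x, hx, rfl⟩, starAut_flipFamily_starAut_flipFamily v x⟩

/-! ## 14. The SAT♮ engine of the column-varying bed -/

/-- **THE SAT♮ ENGINE of CV** (companion of abc-iut-w5-d230's `satNatural_of_holds_at_natSetting`): any candidate `H` of the protocol's arity
that HOLDS at `cvSetting` is jointly satisfiable with typed Thm. 3.11 ∧ «the columns `n−1`, `n` differ» ∧ BridgeHyps ∧ `|log(q)| > 0` ∧
PinnedRegions3 ∧ ALL FOUR levels of record ∧ the Statement with STRICT inequality ∧ `¬IdentifiedReading`. One `exact` per row. [folklore] -/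
theorem satCV_of_holds_at_cvSetting
    (H : ∀ {T : ThetaIndex} (S : LatticeSituation T) (P : Cor312.Setting S.toSituation),
      ((∀ v : T.V, v ∈ T.Vbad → Set (S.L.StarPacket v)) → ∀ (j : T.Label) (vQ : T.VQ), Set (S.L.Packet j vQ)) →
      (∀ v : T.V, v ∈ T.Vbad → Set (S.L.StarPacket v)) → Prop)
    (h : H cvFull.toLatticeSituation cvSetting segRegion qDatumNat) :
    ∃ (T : ThetaIndex) (F : FullSituation T) (P : Cor312.Setting F.toLatticeSituation.toSituation)
      (ρ : (∀ v : T.V, v ∈ T.Vbad → Set (F.L.StarPacket v)) → ∀ (j : T.Label) (vQ : T.VQ), Set (F.L.Packet j vQ))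
      (qK : ∀ v : T.V, v ∈ T.Vbad → Set (F.L.StarPacket v)),
      F.Statement ∧ F.col (P.n - 1) ≠ F.col P.n ∧ BridgeHyps P ∧ P.AbsLogQPos ∧ PinnedRegions3 F.toLatticeSituation P ρ qK ∧
        H F.toLatticeSituation P ρ qK ∧
        PilotKummerCompat F.toLatticeSituation P qK ∧ PilotKummerCompatRegion F.toLatticeSituation P ρ qK ∧
        PilotKummerIndRelated F.toLatticeSituation P ρ qK ∧ PilotKummerCompatHull F.toLatticeSituation P ρ qK ∧
        P.Statement ∧ ((P.negLogQ : ℝ) : WithTop ℝ) < P.negLogTheta ∧ ¬ P.IdentifiedReading :=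
  ⟨toyIndex, cvFull, cvSetting, segRegion, qDatumNat, cvFull_statement, cv_columns_ne, cvSetting_census.1, cvSetting_census.2.1,
    cvSetting_census.2.2.1, h, cvSetting_levels.1, cvSetting_levels.2.1, cvSetting_levels.2.2.1, cvSetting_levels.2.2.2,
    cvSetting_census.2.2.2.2.1, cvSetting_census.2.2.2.2.2, cvSetting_census.2.2.2.1⟩

/-! ## 15. RP-I08a/b/c (`CandInternal9`) on CV -/

/-- **RP-I08a HOLDS at `cvSetting` — with the TRIVIAL transporter `Φ₀ = 1`** ((T1): the q-datum IS the previous column's Kummer image;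
(T2): `1` is ρ-invisible). [claim: Mochizuki2012, status: disputed] -/
theorem I08a_at_cvSetting : CandInternal9.H cvFull.toLatticeSituation cvSetting segRegion qDatumNat := by
  refine ⟨0, 1, CandInternal9.rhoInvisible_one _ _, fun v hv => ?_⟩
  rw [(cv_col_frobΨ 0).2.1, LogShells.starAut_one]
  simp

/-- **RP-I08a FAILS at `cvSettingId`**: a ρ-invisible transporter of `qDatumNat` onto `PsiNat` would identify `halfNeg` with `halfPos`
(through `CandInternal9.hlink_of_H`). [folklore] -/
theorem not_I08a_at_cvSettingId : ¬ CandInternal9.H cvFull.toLatticeSituation cvSettingId segRegion fun v _ => PsiNat v := fun h => by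
  obtain ⟨m₀, hm⟩ := CandInternal9.hlink_of_H _ _ _ _ h
  have e := hm (Setting.labelSucc (⟨0, by decide⟩ : Fin toyIndex.lstar)) ()
  rw [(cv_col_frobΨ m₀).2.2.2] at e
  exact natSetting_regions_ne (Setting.labelSucc_ne_zero _) () e.symm

/-- **RP-I08b `HΘ` FAILS on CV** (at `cvSetting`; the predicate reads no q-datum): a ρ-invisible `Φ₀` with `PsiNat = Φ₀ · qDatumNat` would
give `segRegion PsiNat = segRegion qDatumNat`, i.e. `halfPos = halfNeg`. [folklore] -/
theorem not_I08b_at_cvSetting : ¬ CandInternal9.HΘ cvFull.toLatticeSituation cvSetting segRegion := by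
  rintro ⟨Φ₀, hinv, h⟩
  have e : (fun v (_ : v ∈ toyIndex.Vbad) => PsiNat v) = fun v hv => signShells.starAut Φ₀ v '' qDatumNat v hv := by
    rw [← (cv_col_frobΨ 0).1, ← (cv_col_frobΨ 0).2.1]
    exact funext fun v => funext fun hv => h 0 v hv
  refine natSetting_regions_ne (Setting.labelSucc_ne_zero (⟨0, by decide⟩ : Fin toyIndex.lstar)) () ?_
  show segRegion qDatumNat _ () = segRegion (fun v (_ : v ∈ toyIndex.Vbad) => PsiNat v) _ ()
  rw [e, hinv]

/-- `HΘ` FAILS at `cvSettingId` as well (same columns). [folklore] -/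
theorem not_I08b_at_cvSettingId : ¬ CandInternal9.HΘ cvFull.toLatticeSituation cvSettingId segRegion := not_I08b_at_cvSetting

/-- **RP-I08c `HStab` FAILS on CV** (it reads column `n` only: as at P♮, `flipFamily` moves `PsiNat`). [folklore] -/
theorem not_I08c_at_cvSetting : ¬ CandInternal9.HStab cvFull.toLatticeSituation cvSetting := CandInternal9.HStab_fails_at_natSetting

/-- (T1) `Transport` HOLDS at both CV settings (`Φ₀ = 1`, resp. `Φ₀ = flipFamily`). [folklore] -/
theorem transport_on_CV : CandInternal9.Transport cvFull.toLatticeSituation cvSetting qDatumNat ∧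
    CandInternal9.Transport cvFull.toLatticeSituation cvSettingId fun v _ => PsiNat v :=
  ⟨CandInternal9.transport_of_H _ _ _ _ I08a_at_cvSetting,
    ⟨0, flipFamily, fun v hv => by rw [(cv_col_frobΨ 0).2.2.2, starAut_flipFamily_image_qDatumNat v hv]⟩⟩

/-- **RP-I08a is SAT♮ on CV** (engine §14): jointly satisfiable with typed Thm. 3.11, distinct columns, pins, bridge hypotheses, all four
levels, Statement strict, `¬IdentifiedReading` — upgrade of the P♮ reading «T-c stays SAT0» (`CandInternal9.H_fails_at_natSetting`).
[claim: Mochizuki2012, status: disputed] -/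
theorem I08a_satCV :
    ∃ (T : ThetaIndex) (F : FullSituation T) (P : Cor312.Setting F.toLatticeSituation.toSituation)
      (ρ : (∀ v : T.V, v ∈ T.Vbad → Set (F.L.StarPacket v)) → ∀ (j : T.Label) (vQ : T.VQ), Set (F.L.Packet j vQ))
      (qK : ∀ v : T.V, v ∈ T.Vbad → Set (F.L.StarPacket v)),
      F.Statement ∧ F.col (P.n - 1) ≠ F.col P.n ∧ BridgeHyps P ∧ P.AbsLogQPos ∧ PinnedRegions3 F.toLatticeSituation P ρ qK ∧
        CandInternal9.H F.toLatticeSituation P ρ qK ∧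
        PilotKummerCompat F.toLatticeSituation P qK ∧ PilotKummerCompatRegion F.toLatticeSituation P ρ qK ∧
        PilotKummerIndRelated F.toLatticeSituation P ρ qK ∧ PilotKummerCompatHull F.toLatticeSituation P ρ qK ∧
        P.Statement ∧ ((P.negLogQ : ℝ) : WithTop ℝ) < P.negLogTheta ∧ ¬ P.IdentifiedReading :=
  satCV_of_holds_at_cvSetting (fun S P ρ qK => CandInternal9.H S P ρ qK) I08a_at_cvSetting

/-- **The typed interface does NOT imply RP-I08b**: «typed Thm. 3.11 ∧ BridgeHyps ∧ `|log(q)| > 0` ∧ PinnedRegions3 ∧ `S` ∧ Statement ⟹ `HΘ`»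
is REFUTED (at `cvSetting`) — `HΘ` held on every earlier bed only because their columns were constant. [folklore] -/
theorem not_interface_imp_I08b :
    ¬ ∀ (T : ThetaIndex) (F : FullSituation T) (P : Cor312.Setting F.toLatticeSituation.toSituation)
        (ρ : (∀ v : T.V, v ∈ T.Vbad → Set (F.L.StarPacket v)) → ∀ (j : T.Label) (vQ : T.VQ), Set (F.L.Packet j vQ))
        (qK : ∀ v : T.V, v ∈ T.Vbad → Set (F.L.StarPacket v)),
        F.Statement → BridgeHyps P → P.AbsLogQPos → PinnedRegions3 F.toLatticeSituation P ρ qK →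
          PilotKummerIndRelated F.toLatticeSituation P ρ qK → P.Statement → CandInternal9.HΘ F.toLatticeSituation P ρ := fun h =>
  not_I08b_at_cvSetting (h toyIndex cvFull cvSetting segRegion qDatumNat cvFull_statement cvSetting_census.1 cvSetting_census.2.1
    cvSetting_census.2.2.1 S_at_cvSetting_via_H statement_at_cvSetting_via_H)

/-! ## 16. RP-I12 (`CandInternal12`, transport along a member of a class `𝒞`) on CV -/

/-- **RP-I12 HOLDS at `cvSetting` for EVERY class containing the identity** — in particular for RP-I01's trivial class `{1}`, which FAILS at
P♮ (`CandInternal12.H_one_fails_at_natSetting`): on CV the link, not the inserted indeterminacy, carries the transport.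
[claim: Mochizuki2012, status: disputed] -/
theorem I12_at_cvSetting_of_one_mem {𝒞 : Set signShells.PacketAut} (h1 : (1 : signShells.PacketAut) ∈ 𝒞) :
    CandInternal12.H cvFull.toLatticeSituation cvSetting qDatumNat 𝒞 := by
  refine ⟨0, 1, h1, fun v hv => ?_⟩
  rw [(cv_col_frobΨ 0).2.1, LogShells.starAut_one]
  simp

/-- The trivial class, the indeterminacy class `⟨(Ind1) ∪ (Ind2)⟩` (RP-I02's) and `Set.univ` all transport at `cvSetting`. [folklore] -/
theorem I12_classes_at_cvSetting :
    CandInternal12.H cvFull.toLatticeSituation cvSetting qDatumNat {(1 : signShells.PacketAut)} ∧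
      CandInternal12.H cvFull.toLatticeSituation cvSetting qDatumNat
        (Subgroup.closure (signShells.Ind1Family ∪ signShells.Ind2Family) : Set signShells.PacketAut) ∧
      CandInternal12.H cvFull.toLatticeSituation cvSetting qDatumNat Set.univ :=
  ⟨I12_at_cvSetting_of_one_mem rfl, I12_at_cvSetting_of_one_mem (Subgroup.one_mem _), I12_at_cvSetting_of_one_mem trivial⟩

/-- **At `cvSettingId` RP-I12 HOLDS for every class containing `flipFamily`** (which carries `qDatumNat` back onto `PsiNat`) … [claim: Mochizuki2012, status: disputed] -/
theorem I12_at_cvSettingId_of_flip_mem {𝒞 : Set signShells.PacketAut} (h : flipFamily ∈ 𝒞) :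
    CandInternal12.H cvFull.toLatticeSituation cvSettingId (fun v _ => PsiNat v) 𝒞 :=
  ⟨0, flipFamily, h, fun v hv => by rw [(cv_col_frobΨ 0).2.2.2, starAut_flipFamily_image_qDatumNat v hv]⟩

/-- … and FAILS for the trivial class `{1}` (the data `PsiNat ≠ qDatumNat` already differ in region). [folklore] -/
theorem not_I12_one_at_cvSettingId :
    ¬ CandInternal12.H cvFull.toLatticeSituation cvSettingId (fun v _ => PsiNat v) {(1 : signShells.PacketAut)} := by
  rintro ⟨m₀, Φ₀, hΦ₀, hq⟩
  rw [Set.mem_singleton_iff] at hΦ₀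
  subst hΦ₀
  have e : (fun v (_ : v ∈ toyIndex.Vbad) => PsiNat v) = qDatumNat := by
    rw [← (cv_col_frobΨ m₀).2.2.2]
    exact funext fun v => funext fun hv => by have h' := hq v hv; rw [LogShells.starAut_one] at h'; simpa using h'
  refine natSetting_regions_ne (Setting.labelSucc_ne_zero (⟨0, by decide⟩ : Fin toyIndex.lstar)) () ?_
  show segRegion qDatumNat _ () = segRegion (fun v (_ : v ∈ toyIndex.Vbad) => PsiNat v) _ ()
  rw [e]

/-- RP-I12's trivial-class instance is SAT♮ on CV (engine §14). [claim: Mochizuki2012, status: disputed] -/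
theorem I12_one_satCV :
    ∃ (T : ThetaIndex) (F : FullSituation T) (P : Cor312.Setting F.toLatticeSituation.toSituation)
      (ρ : (∀ v : T.V, v ∈ T.Vbad → Set (F.L.StarPacket v)) → ∀ (j : T.Label) (vQ : T.VQ), Set (F.L.Packet j vQ))
      (qK : ∀ v : T.V, v ∈ T.Vbad → Set (F.L.StarPacket v)),
      F.Statement ∧ F.col (P.n - 1) ≠ F.col P.n ∧ BridgeHyps P ∧ P.AbsLogQPos ∧ PinnedRegions3 F.toLatticeSituation P ρ qK ∧
        CandInternal12.H F.toLatticeSituation P qK {(1 : F.L.PacketAut)} ∧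
        PilotKummerCompat F.toLatticeSituation P qK ∧ PilotKummerCompatRegion F.toLatticeSituation P ρ qK ∧
        PilotKummerIndRelated F.toLatticeSituation P ρ qK ∧ PilotKummerCompatHull F.toLatticeSituation P ρ qK ∧
        P.Statement ∧ ((P.negLogQ : ℝ) : WithTop ℝ) < P.negLogTheta ∧ ¬ P.IdentifiedReading :=
  satCV_of_holds_at_cvSetting (fun S P _ qK => CandInternal12.H S P qK {(1 : S.L.PacketAut)}) (I12_at_cvSetting_of_one_mem rfl)

/-! ## 17. RP-I15 (`CandInternal15`, transport along a units-type family) on CV -/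

/-- **RP-I15 HOLDS at both CV settings** (`Φ₀ = 1`, `unitsType_one`; resp. `Φ₀ = flipFamily`, an (Ind2)-family, `unitsType_of_mem_Ind2Family`)
— as at P♮ (`CandInternal15.H_at_natSetting`): CV does not move this row. [claim: Mochizuki2012, status: disputed] -/
theorem I15_on_CV : CandInternal15.H cvFull.toLatticeSituation cvSetting qDatumNat ∧
    CandInternal15.H cvFull.toLatticeSituation cvSettingId fun v _ => PsiNat v := by
  refine ⟨⟨0, 1, CandInternal15.unitsType_one _, fun v hv => ?_⟩,
    ⟨0, flipFamily, CandInternal15.unitsType_of_mem_Ind2Family flipFamily_mem_Ind2Family, fun v hv => ?_⟩⟩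
  · rw [(cv_col_frobΨ 0).2.1, LogShells.starAut_one]; simp
  · rw [(cv_col_frobΨ 0).2.2.2, starAut_flipFamily_image_qDatumNat v hv]

/-! ## 18. The column-axis profile, packaged -/

/-- **CV PROFILE of the column-reading transport rows** (one conjunction for the TSV): at `cvSetting` — I01 ✓ (part I), I08a ✓, I08b ✗, I08c ✗,
I12{1} ✓, I12⟨Ind⟩ ✓, I15 ✓; at `cvSettingId` — I01b ✓ (part II), I01 ✗, I08a ✗, I08b ✗, I12{1} ✗, I12 with `flipFamily` ✓, I15 ✓.
A model ≠ an endorsement; no side taken. [folklore] -/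
theorem cv_profile :
    (CandInternal3.H cvFull.toLatticeSituation cvSetting segRegion qDatumNat ∧
      CandInternal9.H cvFull.toLatticeSituation cvSetting segRegion qDatumNat ∧
      ¬ CandInternal9.HΘ cvFull.toLatticeSituation cvSetting segRegion ∧
      ¬ CandInternal9.HStab cvFull.toLatticeSituation cvSetting ∧
      CandInternal12.H cvFull.toLatticeSituation cvSetting qDatumNat {(1 : signShells.PacketAut)} ∧
      CandInternal12.H cvFull.toLatticeSituation cvSetting qDatumNat
        (Subgroup.closure (signShells.Ind1Family ∪ signShells.Ind2Family) : Set signShells.PacketAut) ∧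
      CandInternal15.H cvFull.toLatticeSituation cvSetting qDatumNat) ∧
    (CandInternal3.H' cvFull.toLatticeSituation cvSettingId segRegion (fun v _ => PsiNat v) ∧
      ¬ CandInternal3.H cvFull.toLatticeSituation cvSettingId segRegion (fun v _ => PsiNat v) ∧
      ¬ CandInternal9.H cvFull.toLatticeSituation cvSettingId segRegion (fun v _ => PsiNat v) ∧
      ¬ CandInternal9.HΘ cvFull.toLatticeSituation cvSettingId segRegion ∧
      ¬ CandInternal12.H cvFull.toLatticeSituation cvSettingId (fun v _ => PsiNat v) {(1 : signShells.PacketAut)} ∧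
      CandInternal12.H cvFull.toLatticeSituation cvSettingId (fun v _ => PsiNat v)
        (Subgroup.closure (signShells.Ind1Family ∪ signShells.Ind2Family) : Set signShells.PacketAut) ∧
      CandInternal15.H cvFull.toLatticeSituation cvSettingId fun v _ => PsiNat v) :=
  ⟨⟨H_at_cvSetting, I08a_at_cvSetting, not_I08b_at_cvSetting, not_I08c_at_cvSetting, I12_classes_at_cvSetting.1,
      I12_classes_at_cvSetting.2.1, I15_on_CV.1⟩,
    ⟨H'_at_cvSettingId, not_H_at_cvSettingId, not_I08a_at_cvSettingId, not_I08b_at_cvSettingId, not_I12_one_at_cvSettingId,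
      I12_at_cvSettingId_of_flip_mem (Subgroup.subset_closure (Or.inr flipFamily_mem_Ind2Family)), I15_on_CV.2⟩⟩

end Summit.ABC.IUTFork.Repair.ModelColumnVarying

end
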